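import Summits.Ventures.Crystal3D.Theorems.StickyWulffConstantTextureLiminfTexShadowLevelReachBornChainsBarlowTop
import Summits.Ventures.Crystal3D.Theorems.StickyWulffConstantTextureLiminfTexShadowLevelReachBornBarlowMovingTop
import HarnessLib

/-!
# The born SUPPLY census: inner trackable balls of a lamella ≤ K · (ends + cuts + rims) — the canonical launch set run through the bornMoving census
# (lane T, crux `TextureLiminfV5`, stmt-Ventures-23912, registered stub `stub_terraceCensus`; (β) assembly RESUME (d′) «born supply» — both halves composed)

HONEST FRAMING. Venture `Summits/Ventures/Crystal3D` (cell `crystal3d-full`), route `route-Ventures-StickyWulffConstant`, helper `--supports` the law-v5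
crux `TextureLiminfV5` (stmt-Ventures-23912), lane T, mechanism (β).  Census-free on the payer side (no row is applied here), certificate-free; `KissingGap δ` /
`KissingClassification δ` by name; nothing about energies; F-C1 not moved.

THE POINT.  For a lamella frame `A` (dozen none of the four plate dozens) and a root slot `w`, take the CANONICAL born launch set of the direction `c = A w`:
`B⋆ = {p ∈ X : Tr p ∧ ¬ Tr (p − c)}`, `Tr q :↔ q ∈ X ∧ (q FULL / GLIDE / NARROW in A along c) ∧ q − c ∈ X`.  It satisfies the bornMoving census's launch
hypothesis by construction; the census (`bornMoving_barlow_endPairs`, p753363 / `_top`, p753554) bounds its window launches by `#T + #CUT + 220·rims`, and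
the chain lemmas (`card_trackable_inner_le_mul_card_launches`, p753774 / `_top`) bound every finite set `R` of INNER trackable balls by `K ·` those launches
(`h + 4R₀ < K·|c₂|`, heights of `X` in `[−2R₀, h+2R₀]`).  Composition:
* **`inner_trackable_le_census`** (rising `c`) and **`inner_trackable_le_census_top`** (falling `c`):
  `∃ T, #R ≤ K·(#T + #CUT + 220·(#rim_top + #rim_bot))` with `T` carrying lane F's pair / two-payer clauses and the root-class end move in `A` along `c` —
  exactly the family shape `platesFamilies_sources_le_payers_cuts` (p753494) pools under the bi-frame row (direction `d = A w`, frame `A`).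
So the (β) born supply of record is, in the kernel: «#(inner FULL/GLIDE/NARROW balls of the lamella along c) / K» end pairs, poolable under ONE row with the
plates.  What the assembly still owes is the lattice-geometric count of those balls (the lamella's solid volume) and the presentation `Adm A (A w)` (one-letter:
p750661).
WHAT THIS IS NOT: the row, the pooling, the lamella geometry, any certificate; F-C1 not moved.
-/

noncomputable section

namespace Summit.Ventures.Crystal3D.Theorems

open Summit.Ventures.Crystal3D Finset
open Literature.MathematicalPhysics.StatisticalMechanics (barlowPos barlowStacking IsHaggSeq barlowPos_mem basalMirror)
open Summit.Ventures.Crystal3D.Cruxes.TextureLiminf.TexShadow (E3 stacking)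
open scoped InnerProductSpace

section Supply

variable (ver : WordVersion) {δ : ℝ} (hg : KissingGap δ) (hc : KissingClassification δ)
    {σ₁ σ₂ : ℤ → ℤ} (hσ₁ : IsHaggSeq σ₁) (hσ₂ : IsHaggSeq σ₂) (L₁ L₂ : E3 ≃ₗᵢ[ℝ] E3) (s₁ s₂ : E3)
    (A : E3 ≃ₗᵢ[ℝ] E3)
    (hneA₁ : (A : E3 → E3) '' ↑fccSlots ≠ (L₁ : E3 → E3) '' ↑fccSlots)
    (hneA₁' : (A : E3 → E3) '' ↑fccSlots ≠ ((basalMirror.trans L₁ : E3 ≃ₗᵢ[ℝ] E3) : E3 → E3) '' ↑fccSlots)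
    (hneA₂ : (A : E3 → E3) '' ↑fccSlots ≠ (L₂ : E3 → E3) '' ↑fccSlots)
    (hneA₂' : (A : E3 → E3) '' ↑fccSlots ≠ ((basalMirror.trans L₂ : E3 ≃ₗᵢ[ℝ] E3) : E3 → E3) '' ↑fccSlots)
    {w : E3} (hw : w ∈ fccSlots)
    (X P₁ P₂ : Finset E3) (R₀ h ρ : ℝ) (hR₀ : 5 ≤ R₀) (hρ : R₀ + 2 ≤ ρ)
    (hX : ∀ p ∈ X, ∀ q ∈ X, p ≠ q → 1 ≤ dist p q) (hP₁X : P₁ ⊆ X) (hP₂X : P₂ ⊆ X)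
    (hcell : ∀ p ∈ X, -(2 * R₀) ≤ p 2 ∧ p 2 ≤ h + 2 * R₀ ∧ p 0 ^ 2 + p 1 ^ 2 ≤ ρ ^ 2)
    (hP₁ : ∀ p, p ∈ P₁ ↔ (p ∈ stacking L₁ s₁ σ₁ ∧ -(2 * R₀) ≤ p 2 ∧ p 2 ≤ -R₀ ∧ p 0 ^ 2 + p 1 ^ 2 ≤ ρ ^ 2))
    (hP₂ : ∀ p, p ∈ P₂ ↔ (p ∈ stacking L₂ s₂ σ₂ ∧ h + R₀ ≤ p 2 ∧ p 2 ≤ h + 2 * R₀ ∧ p 0 ^ 2 + p 1 ^ 2 ≤ ρ ^ 2))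
    (K : ℕ) (hK : h + 4 * R₀ < K * |(A w) 2|)
include hg hc hσ₁ hσ₂ hneA₁ hneA₁' hneA₂ hneA₂' hw hR₀ hρ hX hP₁X hP₂X hcell hP₁ hP₂ hK

open scoped Classical in
/-- **Inner trackable balls ≤ K · (ends + cuts + rims), RISING direction.**  `R` any finite set of balls `p ∈ X`, straight-moving in `A` along `c = A w`
(`c₂ > 0`) with predecessor `p − c ∈ X`, inner: `−(R₀+1)−1 ≤ p₂ < h + R₀ + 1`, `√(p₀²+p₁²) + (p₂ + (R₀+1) + 2)/c₂ ≤ ρ − 2`. -/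
theorem inner_trackable_le_census (hup : 0 < (A w) 2) (R : Finset E3)
    (hR : ∀ p ∈ R, p ∈ X ∧ (IsFull X A p ∨ (∃ m, IsTwinReading X A m p ∧ ⟪A w, m⟫_ℝ = 0) ∨ (ver = WordVersion.v2 ∧ IsNarrow X A (A w) p)) ∧
      p - A w ∈ X)
    (hRin : ∀ p ∈ R, -(R₀ + 1) - 1 ≤ p 2 ∧ p 2 < h + R₀ + 1 ∧ Real.sqrt (p 0 ^ 2 + p 1 ^ 2) + (p 2 + (R₀ + 1) + 2) / (A w) 2 ≤ ρ - 1 - 1) :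
    ∃ T : Finset (E3 × E3),
      R.card ≤ K * (T.card +
        (X.filter fun b => -(R₀ + 1) - 1 ≤ b 2 ∧ b 2 < h + (R₀ + 1) + 1 ∧
            (∃ μ, ⟪w, μ⟫_ℝ = Real.sqrt (2 / 3) ∧ IsTwinReading X A (A μ) b) ∧ b - A w ∈ X).card +
        220 * (X.filter fun s => h + (R₀ + 1) + 1 ≤ s 2 ∧ s 2 ≤ h + (R₀ + 1) + 1 + 1 ∧
            (ρ - 1 - 2) ^ 2 < s 0 ^ 2 + s 1 ^ 2).card +
        220 * (X.filter fun s => -(R₀ + 1) - 1 - 1 ≤ s 2 ∧ s 2 < -(R₀ + 1) - 1 ∧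
            (ρ - 1 - 1) ^ 2 < s 0 ^ 2 + s 1 ^ 2).card) ∧
      (∀ bq ∈ T, bq.1 ∈ X ∧ bq.2 ∈ X ∧ dist bq.1 bq.2 = 1 ∧ -(R₀ + 1) - 1 ≤ bq.1 2 ∧ bq.1 2 < h + (R₀ + 1) + 1) ∧
      (∀ bq ∈ T, (X.filter fun q => dist bq.1 q = 1).card ≤ 11 ∨
        ∃ z₁ ∈ X, ∃ z₂ ∈ X, z₁ ≠ z₂ ∧ dist bq.1 z₁ = 1 ∧ dist bq.1 z₂ = 1 ∧
          (X.filter fun q => dist z₁ q = 1).card ≤ 11 ∧ (X.filter fun q => dist z₂ q = 1).card ≤ 11) ∧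
      (∀ bq ∈ T, bq.1 - A w ∈ X ∧ bq.2 = bq.1 - A w ∧ ¬ IsMoving X ver A (A w) bq.1 ∧
        bq.2 - A w ∈ X ∧ IsEndMove X ver A (A w) bq.2 bq.1) := by
  -- the canonical launch set
  set Tr : E3 → Prop := fun q => q ∈ X ∧
    (IsFull X A q ∨ (∃ m, IsTwinReading X A m q ∧ ⟪A w, m⟫_ℝ = 0) ∨ (ver = WordVersion.v2 ∧ IsNarrow X A (A w) q)) ∧ q - A w ∈ X with hTrdef
  have hTrI : ∀ q, Tr q → q ∈ X ∧
      (IsFull X A q ∨ (∃ m, IsTwinReading X A m q ∧ ⟪A w, m⟫_ℝ = 0) ∨ (ver = WordVersion.v2 ∧ IsNarrow X A (A w) q)) ∧ q - A w ∈ X :=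
    fun q hq => by rw [hTrdef] at hq; exact hq
  have hTrE : ∀ q, q ∈ X →
      (IsFull X A q ∨ (∃ m, IsTwinReading X A m q ∧ ⟪A w, m⟫_ℝ = 0) ∨ (ver = WordVersion.v2 ∧ IsNarrow X A (A w) q)) → q - A w ∈ X → Tr q :=
    fun q h1 h2 h3 => by rw [hTrdef]; exact ⟨h1, h2, h3⟩
  clear_value Tr
  set B : Finset E3 := X.filter fun p => Tr p ∧ ¬ Tr (p - A w) with hB
  have hborn : ∀ p ∈ B, p ∈ X ∧
      (IsFull X A p ∨ (∃ m, IsTwinReading X A m p ∧ ⟪A w, m⟫_ℝ = 0) ∨ (ver = WordVersion.v2 ∧ IsNarrow X A (A w) p)) ∧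
      p - A w ∈ X ∧
      ¬ (p - A w - A w ∈ X ∧
        (IsFull X A (p - A w) ∨ (∃ m, IsTwinReading X A m (p - A w) ∧ ⟪A w, m⟫_ℝ = 0) ∨
          (ver = WordVersion.v2 ∧ IsNarrow X A (A w) (p - A w)))) := by
    intro p hp
    obtain ⟨-, hT, hno⟩ := mem_filter.1 hp
    obtain ⟨hpX, hmv, hpred⟩ := hTrI p hT
    exact ⟨hpX, hmv, hpred, fun ⟨hpp, hmv'⟩ => hno (hTrE _ hpred hmv' hpp)⟩
  obtain ⟨T, hkey, hTpair, hTpay, hTmove⟩ := bornMoving_barlow_endPairs ver hg hc hσ₂ L₁ L₂ s₁ s₂ A hneA₂ hneA₂' hw hup X P₁ P₂ R₀ h ρ hR₀ hρ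
    hX hP₁X hP₂X hP₁ hP₂ B hborn
  -- the chain count against the window launches of `B`
  have hK' : h + 2 * R₀ - -(2 * R₀) < K * (A w) 2 := by rw [abs_of_pos hup] at hK; linarith
  have hcount := card_trackable_inner_le_mul_card_launches ver hσ₁ L₁ s₁ A hneA₁ hneA₁' hw hup X P₁ R₀ ρ hR₀ hρ hX hP₁X hP₁ h Tr
    (fun q hq => ⟨(hTrI q hq).1, (hTrI q hq).2.1⟩) (fun q hq => ⟨(hcell q hq).1, (hcell q hq).2.1⟩) K hK' R
    (fun p hp => hTrE p (hR p hp).1 (hR p hp).2.1 (hR p hp).2.2) hRin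
  refine ⟨T, (hcount.trans (Nat.mul_le_mul_left K (card_le_card fun b hb => ?_))).trans (Nat.mul_le_mul_left K hkey),
    hTpair, hTpay, hTmove⟩
  obtain ⟨hbX, hT, hn, hwin⟩ := mem_filter.1 hb
  exact mem_filter.2 ⟨mem_filter.2 ⟨hbX, hT, hn⟩, hwin⟩

open scoped Classical in
/-- **Inner trackable balls ≤ K · (ends + cuts + rims), FALLING direction** (`c₂ < 0`; inner: `−(R₀+1) < p₂ < h+(R₀+1)+1`,
`√(p₀²+p₁²) + (h+(R₀+1)+2 − p₂)/|c₂| ≤ ρ − 3`; mirrored rims). -/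
theorem inner_trackable_le_census_top (hdown : (A w) 2 < 0) (R : Finset E3)
    (hR : ∀ p ∈ R, p ∈ X ∧ (IsFull X A p ∨ (∃ m, IsTwinReading X A m p ∧ ⟪A w, m⟫_ℝ = 0) ∨ (ver = WordVersion.v2 ∧ IsNarrow X A (A w) p)) ∧
      p - A w ∈ X)
    (hRin : ∀ p ∈ R, -(R₀ + 1) < p 2 ∧ p 2 < h + (R₀ + 1) + 1 ∧
      Real.sqrt (p 0 ^ 2 + p 1 ^ 2) + (h + (R₀ + 1) + 2 - p 2) / |(A w) 2| ≤ ρ - 1 - 2) :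
    ∃ T : Finset (E3 × E3),
      R.card ≤ K * (T.card +
        (X.filter fun b => -(R₀ + 1) - 1 < b 2 ∧ b 2 ≤ h + (R₀ + 1) + 1 ∧
            (∃ μ, ⟪w, μ⟫_ℝ = Real.sqrt (2 / 3) ∧ IsTwinReading X A (A μ) b) ∧ b - A w ∈ X).card +
        220 * (X.filter fun s => -(R₀ + 1) - 1 - 1 ≤ s 2 ∧ s 2 ≤ -(R₀ + 1) - 1 ∧
            (ρ - 1 - 2) ^ 2 < s 0 ^ 2 + s 1 ^ 2).card +
        220 * (X.filter fun s => h + (R₀ + 1) + 1 < s 2 ∧ s 2 ≤ h + (R₀ + 1) + 1 + 1 ∧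
            (ρ - 1 - 1) ^ 2 < s 0 ^ 2 + s 1 ^ 2).card) ∧
      (∀ bq ∈ T, bq.1 ∈ X ∧ bq.2 ∈ X ∧ dist bq.1 bq.2 = 1 ∧ -(R₀ + 1) - 1 < bq.1 2 ∧ bq.1 2 ≤ h + (R₀ + 1) + 1) ∧
      (∀ bq ∈ T, (X.filter fun q => dist bq.1 q = 1).card ≤ 11 ∨
        ∃ z₁ ∈ X, ∃ z₂ ∈ X, z₁ ≠ z₂ ∧ dist bq.1 z₁ = 1 ∧ dist bq.1 z₂ = 1 ∧
          (X.filter fun q => dist z₁ q = 1).card ≤ 11 ∧ (X.filter fun q => dist z₂ q = 1).card ≤ 11) ∧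
      (∀ bq ∈ T, bq.1 - A w ∈ X ∧ bq.2 = bq.1 - A w ∧ ¬ IsMoving X ver A (A w) bq.1 ∧
        bq.2 - A w ∈ X ∧ IsEndMove X ver A (A w) bq.2 bq.1) := by
  set Tr : E3 → Prop := fun q => q ∈ X ∧
    (IsFull X A q ∨ (∃ m, IsTwinReading X A m q ∧ ⟪A w, m⟫_ℝ = 0) ∨ (ver = WordVersion.v2 ∧ IsNarrow X A (A w) q)) ∧ q - A w ∈ X with hTrdef
  have hTrI : ∀ q, Tr q → q ∈ X ∧
      (IsFull X A q ∨ (∃ m, IsTwinReading X A m q ∧ ⟪A w, m⟫_ℝ = 0) ∨ (ver = WordVersion.v2 ∧ IsNarrow X A (A w) q)) ∧ q - A w ∈ X :=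
    fun q hq => by rw [hTrdef] at hq; exact hq
  have hTrE : ∀ q, q ∈ X →
      (IsFull X A q ∨ (∃ m, IsTwinReading X A m q ∧ ⟪A w, m⟫_ℝ = 0) ∨ (ver = WordVersion.v2 ∧ IsNarrow X A (A w) q)) → q - A w ∈ X → Tr q :=
    fun q h1 h2 h3 => by rw [hTrdef]; exact ⟨h1, h2, h3⟩
  clear_value Tr
  set B : Finset E3 := X.filter fun p => Tr p ∧ ¬ Tr (p - A w) with hB
  have hborn : ∀ p ∈ B, p ∈ X ∧
      (IsFull X A p ∨ (∃ m, IsTwinReading X A m p ∧ ⟪A w, m⟫_ℝ = 0) ∨ (ver = WordVersion.v2 ∧ IsNarrow X A (A w) p)) ∧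
      p - A w ∈ X ∧
      ¬ (p - A w - A w ∈ X ∧
        (IsFull X A (p - A w) ∨ (∃ m, IsTwinReading X A m (p - A w) ∧ ⟪A w, m⟫_ℝ = 0) ∨
          (ver = WordVersion.v2 ∧ IsNarrow X A (A w) (p - A w)))) := by
    intro p hp
    obtain ⟨-, hT, hno⟩ := mem_filter.1 hp
    obtain ⟨hpX, hmv, hpred⟩ := hTrI p hT
    exact ⟨hpX, hmv, hpred, fun ⟨hpp, hmv'⟩ => hno (hTrE _ hpred hmv' hpp)⟩
  obtain ⟨T, hkey, hTpair, hTpay, hTmove⟩ := bornMoving_barlow_endPairs_top ver hg hc hσ₁ L₁ L₂ s₁ s₂ A hneA₁ hneA₁' hw hdown X P₁ P₂ R₀ h ρ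
    hR₀ hρ hX hP₁X hP₂X hP₁ hP₂ B hborn
  have hK' : h + 2 * R₀ - -(2 * R₀) < K * |(A w) 2| := by linarith
  have hcount := card_trackable_inner_le_mul_card_launches_top ver hσ₂ L₂ s₂ A hneA₂ hneA₂' hw hdown X P₂ R₀ h ρ hR₀ hρ hX hP₂X hP₂ Tr
    (fun q hq => ⟨(hTrI q hq).1, (hTrI q hq).2.1⟩) (fun q hq => ⟨(hcell q hq).1, (hcell q hq).2.1⟩) K hK' R
    (fun p hp => hTrE p (hR p hp).1 (hR p hp).2.1 (hR p hp).2.2) hRin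
  refine ⟨T, (hcount.trans (Nat.mul_le_mul_left K (card_le_card fun b hb => ?_))).trans (Nat.mul_le_mul_left K hkey),
    hTpair, hTpay, hTmove⟩
  obtain ⟨hbX, hT, hn, hwin⟩ := mem_filter.1 hb
  exact mem_filter.2 ⟨mem_filter.2 ⟨hbX, hT, hn⟩, hwin⟩

end Supply

end Summit.Ventures.Crystal3D.Theorems

end
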